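import Mathlib
import HarnessLib
import Summits.CriticalPhenomena.CardyFormulaZ2.Theses.CardyComplexCone
import Literature.Probability.Percolation.CardyFormula
import Literature.Probability.Percolation.Crossings
import Literature.Probability.LatticeModels.MedialInterface
import Literature.Probability.LatticeModels.DomainDiscretisation
import Literature.Probability.RandomPlanarGeometry.SLE
import Literature.Probability.RandomPlanarGeometry.CurveSpace
import Literature.Probability.RandomPlanarGeometry.PolygonalDomains

/-!
# Sketch — first-lemma signatures for the crux ideas on `SLESixFamiliesGiveCardy`
(stmt-CriticalPhenomena-9654), ideator 3, round 1.  Signatures only (sorried); they must elaborate.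
-/

open scoped Topology
open Filter Set MeasureTheory

namespace Summit.CriticalPhenomena.CardyFormulaZ2.Cruxes.SLESixFamiliesGiveCardy.Sketch

open Literature.Probability.RandomPlanarGeometry Literature.Probability.Percolation
  Literature.Probability.LatticeModels

/-! ## Card `collar-touch-sandwich` -/

/-- ENGINE (measure theory only; provable now by portmanteau for closed sets): along a family
converging in law to chordal SLE₆ (the conclusion of `H` at one Dobrushin domain), every event
that is EVENTUALLY CONTAINED in "the trace of the interface meets the closed set `K`" has
`limsup`-probability at most the SLE₆-probability that the trace meets `K`
(`CurveClass.hitsBefore K ∅` = "trace meets `K`", closed by `isClosed_hitsBefore_empty_right`). -/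
theorem limsup_le_sle_touch (D : DobrushinDomain)
    (X : ℝ → BondConfig (Site 2) → CurveClass ℂ)
    (hX : ConvergesInLawToSLE 6 D (Ωδ := fun _ => BondConfig (Site 2)) X
      (fun _ => bondPercolation (zdGraph 2) half)) :
    ∃ Γ, IsSLECurve 6 D Γ ∧
      ∀ (K : Set ℂ), IsClosed K → ∀ (E : ℝ → Set (BondConfig (Site 2))),
        (∀ᶠ δ in 𝓝[>] (0 : ℝ), E δ ⊆ {ω | ((X δ ω).range ∩ K).Nonempty}) →
          limsup (fun δ => (bondPercolation (zdGraph 2) half).real (E δ)) (𝓝[>] (0 : ℝ)) ≤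
            (Literature.Probability.Process.preWienerMeasure.map Γ).real
              (CurveClass.hitsBefore K (∅ : Set ℂ)) := by
  sorry

/-- FIRST LEMMA of the line (deterministic, one mesh; the LOWER inclusion
"`¬ C_δ(Q) ⊆ {trace of γ₂ meets the η-neighbourhood of the wired rough arc}`", contraposed):
left-chain extraction.  `E` is admissible Dobrushin data on a domain `E.Ω ⊇ Ω := R.carrier`
(the domain collared behind `(ab)` and `(cd)`), `Uab`, `Ucd` are the mesh vertices of the two
collars, `Xs`, `Ys` the `(ab)`- and `(cd)`-gates (incl. jump vertices), `G` the part of the wired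
arc inside `closure Ω`.  All hypotheses are pointwise geometric facts about the collared domain,
dischargeable separately (tube collars of `ConformalTube`/`CollarDomain`, `MeshStrayExtent`). -/
theorem discreteCrossing_of_trace_avoids (R : ConformalRectangle) (E : DiscreteDobrushin)
    (hadm : E.IsZdAdmissible) (hΩ : R.carrier ⊆ E.Ω) (G : Set ℂ) (η : ℝ) (hη : 8 * E.δ < η)
    (Uab Ucd Xs Ys : Set (Site 2))
    -- collar vertices: cover the mesh vertices of `E.Ω` outside `Ω`, lie outside `Ω`, and the
    -- two collars are not joined by a mesh edge
    (hUcover : ∀ v ∈ meshDomain E.Ω E.δ, meshPoint E.δ v ∉ R.carrier → v ∈ Uab ∨ v ∈ Ucd)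
    (hUout : ∀ v ∈ Uab ∪ Ucd, meshPoint E.δ v ∉ R.carrier)
    (hUsep : ∀ v ∈ Uab, ∀ w ∈ Ucd, ¬ (meshGraph E.Ω E.δ).Adj v w)
    -- gates: entering a collar from `Ω`, or jumping through one, happens at a gate vertex
    (hgate : ∀ v w : Site 2, meshPoint E.δ v ∈ R.carrier → (meshGraph E.Ω E.δ).Adj v w →
      (w ∈ Uab → v ∈ Xs) ∧ (w ∈ Ucd → v ∈ Ys) ∧
      (meshPoint E.δ w ∈ R.carrier → ¬ (meshGraph R.carrier E.δ).Adj v w → v ∈ Xs ∪ Ys))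
    -- gates are discrete-arc vertices once in the bulk, and the two gate sets are separated
    (hXs : ∀ v ∈ Xs, v ∈ meshDomain R.carrier E.δ → v ∈ discreteArc R.carrier E.δ (R.arc 0))
    (hYs : ∀ v ∈ Ys, v ∈ meshDomain R.carrier E.δ → v ∈ discreteArc R.carrier E.δ (R.arc 2))
    (hXY : ∀ v ∈ Xs, ∀ w ∈ Ys, v ≠ w ∧ ¬ (zdGraph 2).Adj v w)
    -- bulk: an `Ω`-mesh walk from a gate of `(ab)` to a gate of `(cd)` lies in `meshDomain Ω δ`
    (hbulk : ∀ (u v : Site 2) (p : (zdGraph 2).Walk u v), u ∈ Xs → v ∈ Ys →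
      (∀ x ∈ p.support, meshPoint E.δ x ∈ R.carrier) →
      (∀ d ∈ p.darts, (meshGraph R.carrier E.δ).Adj d.fst d.snd) →
      ∀ x ∈ p.support, x ∈ meshDomain R.carrier E.δ)
    -- the two A–B edges: the wired end of one lies in the `(ab)`-collar, of the other in the
    -- `(cd)`-collar (exterior marks)
    (hAB : ∃ e₁ ∈ E.zdABEdges, ∃ e₂ ∈ E.zdABEdges, e₁ ≠ e₂ ∧
      (∀ x ∈ e₁, x ∈ E.zdArcA → x ∈ Uab) ∧ (∀ x ∈ e₂, x ∈ E.zdArcA → x ∈ Ucd))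
    -- wired-arc vertices inside `Ω` are `η/2`-close to `G`
    (hA : ∀ v ∈ E.zdArcA, meshPoint E.δ v ∈ R.carrier →
      Metric.infDist (meshPoint E.δ v) G < η / 2) :
    {ω | Disjoint (Set.range (medialExplorationCurve E ω)) (Metric.cthickening η G)} ⊆
      discreteCrossing R.carrier E.δ (R.arc 0) (R.arc 2) := by
  sorry

/-! ## Card `br-sandwich-via-polygons` -/

/-- TRANSFER (H-free half; the `ℤ²` port of the construction-free Bollobás–Riordan sandwich
already formalised for `δ𝕋` in `TriCrossingSandwich(Marked).lean`): Cardy's formula for every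
conformal rectangle whose carrier is the inside of a simple closed polygon implies Cardy's formula
for every conformal rectangle. -/
theorem polygons_suffice
    (h : ∀ (l : List ℂ) (hl : IsSimpleClosedPolygon l) (R : ConformalRectangle),
      R.carrier = (polygonDomain l hl).carrier →
        R.HasCrossingLimit (bondDomainCrossingProb R) cardyFunction) :
    Literature.Probability.Percolation.CardyFormulaZ2 := by
  sorry

/-- The crux decl this folder is about (type-checks that we point at the right constant). -/
example : Prop := Summit.CriticalPhenomena.CardyFormulaZ2.Theses.CardyComplexCone.SLESixFamiliesGiveCardy

end Summit.CriticalPhenomena.CardyFormulaZ2.Cruxes.SLESixFamiliesGiveCardy.Sketch
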